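import Summits.ResolutionOfSingularities.ResolutionOfSingularities.Theorems.PurelyInseparableDim4ChartAtlasSNCGoodChart
import Summits.ResolutionOfSingularities.ResolutionOfSingularities.Theorems.PurelyInseparableDim4ChartAtlasBoundary
import Summits.ResolutionOfSingularities.ResolutionOfSingularities.Theorems.PurelyInseparableDim4ChartAtlasInsidePackage
import Summits.ResolutionOfSingularities.ResolutionOfSingularities.Theorems.PurelyInseparableDim4ChartAtlasGlue
import HarnessLib

/-!
# Purely inseparable four-folds `z^p + F(x₁, …, x₄)`: the GOOD case of the S3-N2 dichotomy at the level of the blown-up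
# scheme `W` — the escaping global centre is snc with the WHOLE transformed boundary (brick S3-N2, positive side; typ-2 g5)

[OURS · counted 0] (D-0157 DOOR 2; DR-157-C; desk WORD #115 (a)/(c), #131 (c)). Setting of the S3-N1 atlas (p688534,
p689648): `π : W → 𝔸⁵` ANY blowing up along `V(z, x_S)`, the walk's point `b` on the `x_j`-chart (`j ∈ S`, `b_j = 0`),
re-centring `Θⱼ` of record (`Θⱼ z = z + h`, `Θⱼ xᵢ = xᵢ + bᵢ`, reading `z^p + F ↦ x_j^p (z^p + F₁)`), next centre variables
`S'` with `F₁` `S'`-permissible, and the GLOBAL centre `Zc` = closure of `φⱼ(V(z, x_{S'}))`. NEW here: an OLD BOUNDARY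
`E = [(xᵢ + cᵢ)·𝒪 : i ∈ ms]` of NEAR translated coordinate hyperplanes (`cᵢ = 0` for `i ∈ S`, typ-3's normalised shape data).
PROVED (no `sorry`, no new axiom):

* `forall_mem_boundary_readings_translate_chart` — on the `x_j`-chart every member of the transformed boundary
  `E.map St ++ [E₁]` reads `⊤` or a translated hyperplane `(xᵢ + c'ᵢ)·𝒪`;
* `forall_mem_boundary_readings_shear_chart` — on a shear chart `x_l` (p696282's dictionary) every member reads `⊤` or
  `(xᵢ + βᵢ·x_j + c'ᵢ)·𝒪` with `βᵢ = bᵢ` exactly on the old members `i ∈ ms ∩ S ∖ {j, l}`;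
* **`hasSNCWith_transform_boundary_globalCentre_of_good`** — if NO old member through the centre is sheared INTO the new
  centre, i.e. `∀ i ∈ ms, i ∈ S → i ∈ S' → i ≠ j → bᵢ = 0` (the bad set of every chart is `⊆ {x_j·𝒪}`, `|B| ≤ 1`), then
  `HasSNCWith ((⟨(z^p+F)·𝒪, E, p⟩.transform π 𝓘Λ_S).boundary) Zc` on `W` (both cases `j ∈ S'` / `j ∉ S'`; glue p692083 over
  the cover p688180/p689648; chart theorem p697351-file `hasSNCWith_𝓘Λ_of_forall_mem_shape`).

With g4's D3 conjuncts (`Zc` regular, `⊆ supp`, readings; p688534/p689648) this makes `Zc` an ADMISSIBLE centre for the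
transformed marked ideal WITH boundary in the good case; the complementary bad case (`|B| ≥ 2`) is refuted (p690374) and
repaired (p691715–p696436). Far members (`i ∈ S`, `cᵢ ≠ 0`) and parallel members of equal index are NOT covered (they leave
the hyperplane alphabet on the charts, cf. p696894). Nothing here is a statement about resolution of singularities in
dimension ≥ 4 / characteristic `p` (NOT proved anywhere in this programme). bears_on: LADDER-RESOLUTION:D157-DOOR2
(res-dim4-pi). Supports stmt-ResolutionOfSingularities-16155 (helper).
-/

-- every declaration of this summit lives under `Summit.ResolutionOfSingularities.ResolutionOfSingularities`
-- (summit = problem), which the duplicate-namespace linter flags; house convention (cf. the Target file).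
set_option linter.dupNamespace false

noncomputable section

open MvPolynomial Finset CategoryTheory AlgebraicGeometry Opposite TopologicalSpace
open AlgebraicGeometry.Scheme.IdealSheafData (ofIdealTop vanishingIdeal)

namespace Summit.ResolutionOfSingularities.ResolutionOfSingularities.Theorems.PIDim4

open Literature.AlgebraicGeometry.Resolution
open Literature.AlgebraicGeometry.Resolution.Hauser2010
open Literature.AlgebraicGeometry.Resolution.AffinePointBlowup (P A γ coord Wtop ξ)
open Literature.Barriers.ResolutionOfSingularities

namespace ChartDictionary

section Readings

variable {K : Type} [Field K] {S : Finset (Fin 4)} {j l : Fin 4} {b : Fin 4 → K} {Θ : A 4 K ≃ₐ[K] A 4 K}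
  {τ : MvPolynomial (Fin 4) K ≃ₐ[K] MvPolynomial (Fin 4) K} {W : Scheme.{0}} {π : W ⟶ P 4 K}

/-! ## §1 Members of the transformed boundary, read on the charts -/

/-- **On the `x_j`-chart (re-centring by the translation `Θⱼ xᵢ = xᵢ + bᵢ`) every member of the transformed boundary
`[St(xᵢ + cᵢ) : i ∈ ms] ++ [E₁]` reads `⊤` or a translated hyperplane `(xᵢ + c'ᵢ)·𝒪`**, where `c'` is any function with
`c'_{i+1} = bᵢ + cᵢ` on `ms ∪ {j}` (`c = 0` on `S`). -/
theorem forall_mem_boundary_readings_translate_chart (hj : j ∈ S) (ms : List (Fin 4)) (c : Fin 4 → K)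
    (hc : ∀ i ∈ S, c i = 0) (hs : ∀ i : Fin 4, Θ (X i.succ) = X i.succ + C (b i)) (c' : Fin (4 + 1) → K)
    (hc' : ∀ i : Fin 4, i ∈ ms ∨ i = j → c' i.succ = b i + c i)
    (hπ : IsBlowup π (AffineCoordBlowup.𝓘Λ 4 K (insert 0 (Fin.succ '' (S : Set (Fin 4)))))) :
    haveI : IsIso (CommRingCat.ofHom (Θ : A 4 K →+* A 4 K)) := (inferInstance : IsIso Θ.toRingEquiv.toCommRingCatIso.hom)
    ∀ D ∈ ((ms.map fun i => ofIdealTop (Ideal.span {(γ 4 K).symm (X i.succ + C (c i))})).map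
        (strictTransformIdeal π (AffineCoordBlowup.𝓘Λ 4 K (insert 0 (Fin.succ '' (S : Set (Fin 4)))))) ++
        [(AffineCoordBlowup.𝓘Λ 4 K (insert 0 (Fin.succ '' (S : Set (Fin 4))))).comap π]).map
        (·.comap (Spec.map (CommRingCat.ofHom (Θ : A 4 K →+* A 4 K)) ≫ AffineCoordBlowup.chartImm hπ (succ_mem_centreVars hj))),
      D = ⊤ ∨ ∃ i : Fin (4 + 1), D = ofIdealTop (Ideal.span {(γ 4 K).symm (X i + C (0 : K) * X j.succ + C (c' i))}) := by
  intro D hD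
  rw [List.map_append, List.map_map, List.map_map, List.mem_append, List.mem_map, List.map_singleton,
    List.mem_singleton] at hD
  rcases hD with ⟨i, hi, rfl⟩ | rfl
  · by_cases hij : i = j
    · subst hij
      left
      simp only [Function.comp_apply]
      rw [hc i hj, C_0, add_zero, Scheme.IdealSheafData.comap_comp,
        show (γ 4 K).symm (X i.succ) = coord 4 K i.succ from rfl, strictTransformIdeal_hyperplane_self_comap_chartImm hj hπ,
        Scheme.IdealSheafData.comap_top]
    · right
      refine ⟨i.succ, ?_⟩
      simp only [Function.comp_apply]
      rw [C_0, zero_mul, add_zero, hc' i (Or.inl hi), Scheme.IdealSheafData.comap_comp]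
      by_cases hiS : i ∈ S
      · rw [hc i hiS, C_0, add_zero, add_zero, show (γ 4 K).symm (X i.succ) = coord 4 K i.succ from rfl,
          strictTransformIdeal_hyperplane_comap_chartImm hj hij hπ,
          show coord 4 K i.succ = (γ 4 K).symm (X i.succ) from rfl, comap_ofIdealTop_span_γ_symm, RingHom.coe_coe, hs i]
      · have hC : Θ (C (c i)) = C (c i) := Θ.commutes (c i)
        rw [strictTransformIdeal_translate_comap_chartImm hj hiS (c i) hπ, comap_ofIdealTop_span_γ_symm, RingHom.coe_coe,
          map_add, hs i, hC, add_assoc, ← C_add]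
  · right
    refine ⟨j.succ, ?_⟩
    rw [C_0, zero_mul, add_zero, hc' j (Or.inr rfl), hc j hj, add_zero, Scheme.IdealSheafData.comap_comp,
      comap_𝓘Λ_chartImm hj hπ, show coord 4 K j.succ = (γ 4 K).symm (X j.succ) from rfl, comap_ofIdealTop_span_γ_symm,
      RingHom.coe_coe, hs j]

/-- **On a shear chart `x_l` (`l ∈ S ∖ {j}`, re-centring `Θ` with `Θ|ₓ = τ`: `τ x_j = x_j`, `τ xᵢ = xᵢ + bᵢ x_j` on
`S ∖ {j, l}`, `τ x_k = x_k + b_k` off `S`; `E₁` reads `x_l·𝒪`) every member of the transformed boundary reads `⊤` or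
`(xᵢ + βᵢ·x_j + c'ᵢ)·𝒪`** for any functions `β, c'` with `β_{i+1} = bᵢ` on `ms ∩ S ∖ {j, l}`, `β_{i+1} = 0` on `ms ∖ S` and at
`j, l`, `c'_{i+1} = 0` on `S`, `c'_{i+1} = bᵢ + cᵢ` on `ms ∖ S` (p696282's dictionary, member by member). -/
theorem forall_mem_boundary_readings_shear_chart (hl : l ∈ S) (hjl : j ≠ l) (ms : List (Fin 4)) (c : Fin 4 → K)
    (hc : ∀ i ∈ S, c i = 0) (hτ : ∀ k : Fin 4, Θ (X k.succ) = rename Fin.succ (τ (X k))) (hτj : τ (X j) = X j)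
    (hτS : ∀ i ∈ S, i ≠ j → i ≠ l → τ (X i) = X i + C (b i) * X j) (hτk : ∀ k ∉ S, τ (X k) = X k + C (b k))
    (β c' : Fin (4 + 1) → K) (hβS : ∀ i ∈ ms, i ∈ S → i ≠ j → i ≠ l → β i.succ = b i) (hβj : β j.succ = 0) (hβl : β l.succ = 0)
    (hβk : ∀ i ∈ ms, i ∉ S → β i.succ = 0) (hc'S : ∀ i ∈ S, c' i.succ = 0) (hc'k : ∀ i ∈ ms, i ∉ S → c' i.succ = b i + c i)
    (hπ : IsBlowup π (AffineCoordBlowup.𝓘Λ 4 K (insert 0 (Fin.succ '' (S : Set (Fin 4))))))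
    (hE₁ : haveI : IsIso (CommRingCat.ofHom (Θ : A 4 K →+* A 4 K)) :=
        (inferInstance : IsIso Θ.toRingEquiv.toCommRingCatIso.hom)
      ((AffineCoordBlowup.𝓘Λ 4 K (insert 0 (Fin.succ '' (S : Set (Fin 4))))).comap π).comap
        (Spec.map (CommRingCat.ofHom (Θ : A 4 K →+* A 4 K)) ≫ AffineCoordBlowup.chartImm hπ (succ_mem_centreVars hl)) =
        ofIdealTop (Ideal.span {(γ 4 K).symm (X l.succ + C 0)})) :
    haveI : IsIso (CommRingCat.ofHom (Θ : A 4 K →+* A 4 K)) := (inferInstance : IsIso Θ.toRingEquiv.toCommRingCatIso.hom)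
    ∀ D ∈ ((ms.map fun i => ofIdealTop (Ideal.span {(γ 4 K).symm (X i.succ + C (c i))})).map
        (strictTransformIdeal π (AffineCoordBlowup.𝓘Λ 4 K (insert 0 (Fin.succ '' (S : Set (Fin 4)))))) ++
        [(AffineCoordBlowup.𝓘Λ 4 K (insert 0 (Fin.succ '' (S : Set (Fin 4))))).comap π]).map
        (·.comap (Spec.map (CommRingCat.ofHom (Θ : A 4 K →+* A 4 K)) ≫ AffineCoordBlowup.chartImm hπ (succ_mem_centreVars hl))),
      D = ⊤ ∨ ∃ i : Fin (4 + 1), D = ofIdealTop (Ideal.span {(γ 4 K).symm (X i + C (β i) * X j.succ + C (c' i))}) := by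
  intro D hD
  rw [List.map_append, List.map_map, List.map_map, List.mem_append, List.mem_map, List.map_singleton,
    List.mem_singleton] at hD
  rcases hD with ⟨i, hi, rfl⟩ | rfl
  · by_cases hil : i = l
    · subst hil
      left
      simp only [Function.comp_apply]
      rw [hc i hl, C_0, add_zero, show (γ 4 K).symm (X i.succ) = coord 4 K i.succ from rfl]
      exact comap_shear_chart_strictTransform_hyperplane_self hl _ hπ
    · right
      refine ⟨i.succ, ?_⟩
      simp only [Function.comp_apply]
      by_cases hiS : i ∈ S
      · rw [hc i hiS, C_0, add_zero, hc'S i hiS, C_0, add_zero, show (γ 4 K).symm (X i.succ) = coord 4 K i.succ from rfl]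
        by_cases hij : i = j
        · subst hij
          rw [hβj, C_0, zero_mul, add_zero]
          exact comap_shear_chart_strictTransform_hyperplane_j hl hjl hτ hτj hπ
        · rw [hβS i hi hiS hij hil]
          exact comap_shear_chart_strictTransform_hyperplane_shear hl hil hτ (hτS i hiS hij hil) hπ
      · rw [hβk i hi hiS, C_0, zero_mul, add_zero, hc'k i hi hiS]
        exact comap_shear_chart_strictTransform_translate hl hiS (c i) hτ (hτk i hiS) hπ
  · right
    refine ⟨l.succ, ?_⟩
    rw [hβl, C_0, zero_mul, add_zero, hc'S l hl]
    exact hE₁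

end Readings

/-! ## §2 The W-level theorem -/

variable {K : Type} [Field K] {p : ℕ} [hp : Fact p.Prime] [CharP K p]
  {S S' : Finset (Fin 4)} {j : Fin 4} {b : Fin 4 → K} {Θⱼ : A 4 K ≃ₐ[K] A 4 K} {h : MvPolynomial (Fin 4) K}
  {F F₁ : MvPolynomial (Fin 4) K} {W : Scheme.{0}} {π : W ⟶ P 4 K}

/-- **THE GOOD CASE OF S3-N2 ON `W`: the escaping global centre is snc with the whole transformed boundary.** Old boundary
`E = [(xᵢ + cᵢ)·𝒪 : i ∈ ms]`, `c = 0` on `S`; `π` ANY blowing up of `𝔸⁵` along `V(z, x_S)`; `Θⱼ` the re-centring of record of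
the `x_j`-chart at `b` (`b_j = 0`) with reading `z^p + F ↦ x_j^p (z^p + F₁)`, `F ≠ 0` clean `S`-permissible, `F₁`
`S'`-permissible; GOODNESS: `∀ i ∈ ms, i ∈ S → i ∈ S' → i ≠ j → bᵢ = 0`. Then
`HasSNCWith ((⟨(z^p+F)·𝒪, E, p⟩.transform π 𝓘Λ_S).boundary) Zc`, `Zc` = closure of `φⱼ(V(z, x_{S'}))`. -/
theorem hasSNCWith_transform_boundary_globalCentre_of_good [IsAlgClosed K] (hj : j ∈ S) (hbj : b j = 0) (hF : F ≠ 0)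
    (hclean : HauserPerlega.IsClean p F) (h0j : Θⱼ (X 0) = X 0 + rename Fin.succ h)
    (hsj : ∀ i : Fin 4, Θⱼ (X i.succ) = X i.succ + C (b i))
    (hπ : IsBlowup π (AffineCoordBlowup.𝓘Λ 4 K (insert 0 (Fin.succ '' (S : Set (Fin 4))))))
    (hperm : (p : ℕ∞) ≤ CentreBlowup.ordAlong S F)
    (hread : Θⱼ (coordBlowupSubst K (insert 0 (Fin.succ '' (S : Set (Fin 4)))) j.succ (hyp p F)) = X j.succ ^ p * hyp p F₁)
    (hperm' : (p : ℕ∞) ≤ CentreBlowup.ordAlong S' F₁) (ms : List (Fin 4)) (c : Fin 4 → K) (hc : ∀ i ∈ S, c i = 0)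
    (hgood : ∀ i ∈ ms, i ∈ S → i ∈ S' → i ≠ j → b i = 0) :
    haveI : IsIso (CommRingCat.ofHom (Θⱼ : A 4 K →+* A 4 K)) := (inferInstance : IsIso Θⱼ.toRingEquiv.toCommRingCatIso.hom)
    HasSNCWith
      ((⟨hypSheaf p F, ms.map fun i => ofIdealTop (Ideal.span {(γ 4 K).symm (X i.succ + C (c i))}), p⟩ :
          MarkedIdeal (P 4 K)).transform π (AffineCoordBlowup.𝓘Λ 4 K (insert 0 (Fin.succ '' (S : Set (Fin 4)))))).boundary
      (vanishingIdeal (closureImage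
        (Spec.map (CommRingCat.ofHom (Θⱼ : A 4 K →+* A 4 K)) ≫ AffineCoordBlowup.chartImm hπ (succ_mem_centreVars hj))
        ((AffineCoordBlowup.𝓘Λ 4 K (insert 0 (Fin.succ '' (S' : Set (Fin 4))))).support : Set (P 4 K)))) := by
  classical
  haveI hisoj : IsIso (CommRingCat.ofHom (Θⱼ : A 4 K →+* A 4 K)) :=
    (inferInstance : IsIso Θⱼ.toRingEquiv.toCommRingCatIso.hom)
  haveI : IsProper π := hπ.isProper
  haveI : IsLocallyNoetherian W := LocallyOfFiniteType.isLocallyNoetherian π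
  set Λ : Set (Fin (4 + 1)) := insert 0 (Fin.succ '' (S : Set (Fin 4))) with hΛ
  set φⱼ := Spec.map (CommRingCat.ofHom (Θⱼ : A 4 K →+* A 4 K)) ≫ AffineCoordBlowup.chartImm hπ (succ_mem_centreVars hj)
    with hφⱼ
  set Zc := vanishingIdeal (closureImage φⱼ
    ((AffineCoordBlowup.𝓘Λ 4 K (insert 0 (Fin.succ '' (S' : Set (Fin 4))))).support : Set (P 4 K))) with hZc
  set E : List (Scheme.IdealSheafData (P 4 K)) := ms.map fun i => ofIdealTop (Ideal.span {(γ 4 K).symm (X i.succ + C (c i))})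
    with hEdef
  -- (i) the old boundary has snc with the centre, so the transformed boundary is snc on `W`
  have hE : HasSNCWith E (AffineCoordBlowup.𝓘Λ 4 K Λ) := by
    let c5 : Fin (4 + 1) → K := Fin.cases 0 c
    have hc5 : ∀ i ∈ Λ, c5 i = 0 := by
      rintro i (rfl | ⟨k, hk, rfl⟩)
      · rfl
      · exact hc k (Finset.mem_coe.mp hk)
    have h0 := hasSNCWith_translatedHyperplanes_𝓘Λ (K := K) (ms.map Fin.succ) c5 Λ hc5
    rw [List.map_map] at h0
    exact h0
  have hsncW : HasSNC (((⟨hypSheaf p F, E, p⟩ : MarkedIdeal (P 4 K)).transform π (AffineCoordBlowup.𝓘Λ 4 K Λ)).boundary) := by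
    rw [MarkedIdeal.transform_boundary]
    exact hE.hasSNC_transform hπ
  -- (ii) the cover of `V(Zc)` by the charts `x_l`, `l ∈ S ∖ (S' ∖ {j})`
  have hcov : (Zc.support : Set W) ⊆ ⋃ (l : Fin 4) (hl : l ∈ S \ S'.erase j),
      ((AffineCoordBlowup.chartImm hπ (succ_mem_centreVars (Finset.mem_sdiff.mp hl).1)).opensRange : Set W) := by
    by_cases hjS' : j ∈ S'
    · exact support_globalCentre_subset_iUnion_of_mem hj hjS' hbj h0j hsj hπ hperm hread hperm'
    · rw [Finset.erase_eq_of_notMem hjS']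
      exact support_globalCentre_subset_iUnion hj hjS' hbj h0j hsj hπ hperm hread hperm'
  -- (iii) the shear charts `l ≠ j`: re-centrings and readings (S3-N1 atlas), with the centre variables `T_l` of the reading
  have hchart : ∀ l : {l : Fin 4 // l ∈ S \ S'.erase j}, l.1 ≠ j →
      ∃ (Θ : A 4 K ≃ₐ[K] A 4 K) (τ : MvPolynomial (Fin 4) K ≃ₐ[K] MvPolynomial (Fin 4) K)
        (_ : IsIso (CommRingCat.ofHom (Θ : A 4 K →+* A 4 K))) (T : Finset (Fin 4)),
        (∀ i : Fin 4, Θ (X i.succ) = rename Fin.succ (τ (X i))) ∧ τ (X j) = X j ∧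
        (∀ i ∈ S, i ≠ j → i ≠ l.1 → τ (X i) = X i + C (b i) * X j) ∧ (∀ k ∉ S, τ (X k) = X k + C (b k)) ∧
        j ∉ T ∧ (∀ i ∈ T, i ∈ S → i ≠ l.1 → i ∈ S') ∧
        Zc.comap (Spec.map (CommRingCat.ofHom (Θ : A 4 K →+* A 4 K)) ≫
            AffineCoordBlowup.chartImm hπ (succ_mem_centreVars (Finset.mem_sdiff.mp l.2).1)) =
          AffineCoordBlowup.𝓘Λ 4 K (insert 0 (Fin.succ '' (T : Set (Fin 4)))) ∧
        ((AffineCoordBlowup.𝓘Λ 4 K Λ).comap π).comap (Spec.map (CommRingCat.ofHom (Θ : A 4 K →+* A 4 K)) ≫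
            AffineCoordBlowup.chartImm hπ (succ_mem_centreVars (Finset.mem_sdiff.mp l.2).1)) =
          ofIdealTop (Ideal.span {(γ 4 K).symm (X l.1.succ + C 0)}) := by
    intro l hlj
    obtain ⟨hlS, hlS'e⟩ := Finset.mem_sdiff.mp l.2
    have hlS' : l.1 ∉ S' := fun h' => hlS'e (Finset.mem_erase.mpr ⟨hlj, h'⟩)
    by_cases hjS' : j ∈ S'
    · obtain ⟨Θ, τ, g, hiso, -, hτ, hτj, -, hτS, hτk, -, hZ, -, -, -, hE1⟩ :=
        exists_shear_chart_reading_of_mem hj hjS' hbj hF hclean h0j hsj hπ hperm hread hperm' hlS hlS'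
      refine ⟨Θ, τ, hiso, insert l.1 (S'.erase j), hτ, hτj, hτS, hτk, ?_, ?_, hZ, hE1⟩
      · intro h'
        rcases Finset.mem_insert.mp h' with h' | h'
        · exact hlj h'.symm
        · exact (Finset.notMem_erase j S') h'
      · intro i hi _ hil
        rcases Finset.mem_insert.mp hi with hi | hi
        · exact absurd hi hil
        · exact Finset.mem_of_mem_erase hi
    · obtain ⟨Θ, τ, g, hiso, -, hτ, hτj, -, hτS, hτk, -, hZ, -, -, -, hE1⟩ :=
        exists_shear_chart_reading hj hjS' hbj hF hclean h0j hsj hπ hperm hread hperm' hlS hlS' (Ne.symm hlj)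
      exact ⟨Θ, τ, hiso, S', hτ, hτj, hτS, hτk, hjS', fun i hi _ _ => hi, hZ, hE1⟩
  choose Θf τf hisof Tf hτf hτjf hτSf hτkf hjTf hTf hZf hE1f using hchart
  -- the family of re-centred chart immersions
  let U : {l : Fin 4 // l ∈ S \ S'.erase j} → Scheme.{0} := fun _ => P 4 K
  let φ : ∀ l : {l : Fin 4 // l ∈ S \ S'.erase j}, U l ⟶ W := fun l =>
    if hlj : l.1 = j then φⱼ
    else Spec.map (CommRingCat.ofHom (Θf l hlj : A 4 K →+* A 4 K)) ≫
      AffineCoordBlowup.chartImm hπ (succ_mem_centreVars (Finset.mem_sdiff.mp l.2).1)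
  haveI hφ : ∀ l, IsOpenImmersion (φ l) := fun l => by
    by_cases hlj : l.1 = j
    · simp only [φ, dif_pos hlj, hφⱼ]
      infer_instance
    · simp only [φ, dif_neg hlj]
      haveI := hisof l hlj
      infer_instance
  refine hasSNCWith_of_cover_comap φ hsncW ?_ fun l => ?_
  · -- the re-centred charts cover `V(Zc)`
    intro w hw
    obtain ⟨l, hl⟩ := Set.mem_iUnion.mp (hcov hw)
    obtain ⟨hl, hw'⟩ := Set.mem_iUnion.mp hl
    refine Set.mem_iUnion.mpr ⟨⟨l, hl⟩, ?_⟩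
    by_cases hlj : l = j
    · subst hlj
      simp only [φ, dif_pos rfl, hφⱼ]
      rw [range_specMap_comp_chartImm]
      exact hw'
    · simp only [φ, dif_neg hlj]
      rw [range_specMap_comp_chartImm]
      exact hw'
  · by_cases hlj : l.1 = j
    · -- the `x_j`-chart: translation only, all members translated hyperplanes (far ones harmless)
      simp only [φ, dif_pos hlj]
      rw [hφⱼ, comap_globalCentre, MarkedIdeal.transform_boundary]
      refine hasSNCWith_𝓘Λ_of_forall_mem_shape (T := S') (j := j) (β := fun _ => (0 : K))
        (c := Fin.cases (0 : K) fun i => b i + c i) rfl (fun _ _ => rfl) rfl ?_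
      exact forall_mem_boundary_readings_translate_chart hj ms c hc hsj _ (fun i _ => rfl) hπ
    · -- a shear chart `x_l`: the boundary dictionary, no in-centre sheared member by goodness
      simp only [φ, dif_neg hlj]
      rw [hZf l hlj, MarkedIdeal.transform_boundary]
      obtain ⟨hlS, -⟩ := Finset.mem_sdiff.mp l.2
      haveI := hisof l hlj
      let β : Fin (4 + 1) → K := Fin.cases 0 fun i => if i ∈ ms ∧ i ∈ S ∧ i ≠ j ∧ i ≠ l.1 then b i else 0
      let c' : Fin (4 + 1) → K := Fin.cases 0 fun i => if i ∈ S then 0 else b i + c i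
      have hβsucc : ∀ i : Fin 4, β i.succ = if i ∈ ms ∧ i ∈ S ∧ i ≠ j ∧ i ≠ l.1 then b i else 0 := fun i => rfl
      have hc'succ : ∀ i : Fin 4, c' i.succ = if i ∈ S then 0 else b i + c i := fun i => rfl
      refine hasSNCWith_𝓘Λ_of_forall_mem_shape (T := Tf l hlj) (j := j) (β := β) (c := c') ?_ ?_ rfl ?_
      · rw [hβsucc, if_neg (fun h' => h'.2.2.1 rfl)]
      · rintro i (rfl | ⟨k, hk, rfl⟩)
        · rfl
        · rw [hβsucc]
          by_cases hcond : k ∈ ms ∧ k ∈ S ∧ k ≠ j ∧ k ≠ l.1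
          · rw [if_pos hcond]
            exact hgood k hcond.1 hcond.2.1 (hTf l hlj k (Finset.mem_coe.mp hk) hcond.2.1 hcond.2.2.2) hcond.2.2.1
          · rw [if_neg hcond]
      · refine forall_mem_boundary_readings_shear_chart hlS (Ne.symm hlj) ms c hc (hτf l hlj) (hτjf l hlj) (hτSf l hlj)
          (hτkf l hlj) β c' (fun i hi hiS hij hil => by rw [hβsucc, if_pos ⟨hi, hiS, hij, hil⟩]) ?_ ?_
          (fun i hi hiS => by rw [hβsucc, if_neg (fun h' => hiS h'.2.1)]) (fun i hiS => by rw [hc'succ, if_pos hiS])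
          (fun i _ hiS => by rw [hc'succ, if_neg hiS]) hπ (hE1f l hlj)
        · rw [hβsucc, if_neg (fun h' => h'.2.2.1 rfl)]
        · rw [hβsucc, if_neg (fun h' => h'.2.2.2 rfl)]

/-- **THE S3-N1 ATLAS PACKAGE WITH AN OLD BOUNDARY (good case).** p689648's `globalCentre_atlas_package` for the marked ideal
`((z^p + s.F)·𝒪, E, p)` with a near old boundary `E = [(xᵢ + cᵢ)·𝒪 : i ∈ ms]` (`c = 0` on `S`) under GOODNESS
`∀ i ∈ ms, i ∈ S → i ∈ S' → i ≠ j → bᵢ = 0`: the same re-centring `Θⱼ`, global centre `Zc`, cover and chart readings, and now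
ALL THREE admissibility conjuncts (`Zc` regular, `V(Zc) ⊆ supp M'`, `HasSNCWith M'.boundary Zc`) for the transform WITH boundary. -/
theorem globalCentre_atlas_package_boundary [IsAlgClosed K] [DecidableEq K] (hj : j ∈ S) (hbj : b j = 0) (s : State K)
    (hF : s.F ≠ 0) (hclean : HauserPerlega.IsClean p s.F) (hperm : (p : ℕ∞) ≤ CentreBlowup.ordAlong S s.F)
    (hπ : IsBlowup π (AffineCoordBlowup.𝓘Λ 4 K (insert 0 (Fin.succ '' (S : Set (Fin 4))))))
    (hperm' : (p : ℕ∞) ≤ CentreBlowup.ordAlong S' (CentreBlowup.step p S j b s).F)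
    (ms : List (Fin 4)) (c : Fin 4 → K) (hc : ∀ i ∈ S, c i = 0) (hgood : ∀ i ∈ ms, i ∈ S → i ∈ S' → i ≠ j → b i = 0) :
    ∃ (Θⱼ : A 4 K ≃ₐ[K] A 4 K) (h : MvPolynomial (Fin 4) K) (_ : IsIso (CommRingCat.ofHom (Θⱼ : A 4 K →+* A 4 K))),
      Θⱼ (X 0) = X 0 + rename Fin.succ h ∧ (∀ i : Fin 4, Θⱼ (X i.succ) = X i.succ + C (b i)) ∧
      let φⱼ := Spec.map (CommRingCat.ofHom (Θⱼ : A 4 K →+* A 4 K)) ≫ AffineCoordBlowup.chartImm hπ (succ_mem_centreVars hj)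
      let Zc := vanishingIdeal (closureImage φⱼ ((AffineCoordBlowup.𝓘Λ 4 K
        (insert 0 (Fin.succ '' (S' : Set (Fin 4))))).support : Set (P 4 K)))
      let M' := ((⟨hypSheaf p s.F, ms.map fun i => ofIdealTop (Ideal.span {(γ 4 K).symm (X i.succ + C (c i))}), p⟩ :
        MarkedIdeal (P 4 K)).transform π (AffineCoordBlowup.𝓘Λ 4 K (insert 0 (Fin.succ '' (S : Set (Fin 4))))))
      (M'.ideal.comap φⱼ = hypSheaf p (CentreBlowup.step p S j b s).F ∧
        Zc.comap φⱼ = AffineCoordBlowup.𝓘Λ 4 K (insert 0 (Fin.succ '' (S' : Set (Fin 4)))) ∧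
        Scheme.IsRegular Zc.subscheme ∧ (Zc.support : Set W) ⊆ M'.support ∧ HasSNCWith M'.boundary Zc) ∧
      ((Zc.support : Set W) ⊆ ⋃ (l : Fin 4) (hl : l ∈ S \ S'.erase j),
        ((AffineCoordBlowup.chartImm hπ (succ_mem_centreVars (Finset.mem_sdiff.mp hl).1)).opensRange : Set W)) ∧
      ∀ (l : Fin 4) (hl : l ∈ S), l ∉ S' → j ≠ l →
        ∃ (Θ : A 4 K ≃ₐ[K] A 4 K) (τ : MvPolynomial (Fin 4) K ≃ₐ[K] MvPolynomial (Fin 4) K) (g : MvPolynomial (Fin 4) K)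
          (_ : IsIso (CommRingCat.ofHom (Θ : A 4 K →+* A 4 K))),
          Θ (X 0) = X 0 + rename Fin.succ g ∧ (∀ i : Fin 4, Θ (X i.succ) = rename Fin.succ (τ (X i))) ∧
          τ (X j) = X j ∧ τ (X l) = X l ∧ (∀ i ∈ S, i ≠ j → i ≠ l → τ (X i) = X i + C (b i) * X j) ∧
          (∀ k ∉ S, τ (X k) = X k + C (b k)) ∧
          let φ := Spec.map (CommRingCat.ofHom (Θ : A 4 K →+* A 4 K)) ≫
            AffineCoordBlowup.chartImm hπ (succ_mem_centreVars hl)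
          let Fl := g ^ p + τ (CentreBlowup.chartTransform p S l s.F)
          let Tl : Finset (Fin 4) := if j ∈ S' then insert l (S'.erase j) else S'
          M'.ideal.comap φ = hypSheaf p Fl ∧
          Zc.comap φ = AffineCoordBlowup.𝓘Λ 4 K (insert 0 (Fin.succ '' (Tl : Set (Fin 4)))) ∧
          Fl ≠ 0 ∧ HauserPerlega.IsClean p Fl ∧ (p : ℕ∞) ≤ CentreBlowup.ordAlong Tl Fl ∧
          ((AffineCoordBlowup.𝓘Λ 4 K (insert 0 (Fin.succ '' (S : Set (Fin 4))))).comap π).comap φ =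
            ofIdealTop (Ideal.span {(γ 4 K).symm (X l.succ + C 0)}) := by
  haveI : PerfectRing K p := PerfectRing.ofSurjective K p fun x => IsAlgClosed.exists_pow_nat_eq x hp.out.pos
  obtain ⟨θ, h, h0, hs, h1, -⟩ := exists_clean_translate_hyp_eq_step p hj hbj s hperm
  -- the re-centring of record of the `x_j`-chart: translation by `b`, then cleaning by `h` (as in p688534 / p689648)
  let Θⱼ : A 4 K ≃ₐ[K] A 4 K := (AffinePointBlowup.translateEquiv (Fin.cases 0 b)).trans θ
  have hΘ0 : Θⱼ (X 0) = X 0 + rename Fin.succ h := by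
    change θ (AffinePointBlowup.translateEquiv (Fin.cases 0 b) (X 0)) = _
    rw [AffinePointBlowup.translateEquiv_X, Fin.cases_zero, C_0, add_zero, h0]
  have hΘs : ∀ i : Fin 4, Θⱼ (X i.succ) = X i.succ + C (b i) := fun i => by
    change θ (AffinePointBlowup.translateEquiv (Fin.cases 0 b) (X i.succ)) = _
    rw [AffinePointBlowup.translateEquiv_X, Fin.cases_succ, map_add, hs]
    exact congrArg _ (θ.commutes (b i))
  have hread : Θⱼ (coordBlowupSubst K (insert 0 (Fin.succ '' (S : Set (Fin 4)))) j.succ (hyp p s.F)) =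
      X j.succ ^ p * hyp p (CentreBlowup.step p S j b s).F := by
    change θ (AffinePointBlowup.translateEquiv (Fin.cases 0 b) _) = _
    rw [← h1]
    rfl
  haveI hiso : IsIso (CommRingCat.ofHom (Θⱼ : A 4 K →+* A 4 K)) :=
    (inferInstance : IsIso Θⱼ.toRingEquiv.toCommRingCatIso.hom)
  refine ⟨Θⱼ, h, hiso, hΘ0, hΘs, ⟨?_, ?_, ?_, ?_, ?_⟩, ?_, fun l hl hlS' hjl => ?_⟩
  · exact comap_chart_transform_ideal_of_reading hj hbj hΘ0 hΘs hπ hperm hread _ rfl rfl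
  · exact comap_globalCentre _ _
  · exact isRegular_globalCentre_of_reading hj hbj hΘ0 hΘs hπ hperm hread hperm'
  · exact support_globalCentre_subset_support_transform hj hbj hΘ0 hΘs hπ hperm hread hperm'
  · exact hasSNCWith_transform_boundary_globalCentre_of_good hj hbj hF hclean hΘ0 hΘs hπ hperm hread hperm' ms c hc hgood
  · by_cases hjS' : j ∈ S'
    · exact support_globalCentre_subset_iUnion_of_mem hj hjS' hbj hΘ0 hΘs hπ hperm hread hperm'
    · rw [Finset.erase_eq_of_notMem hjS']
      exact support_globalCentre_subset_iUnion hj hjS' hbj hΘ0 hΘs hπ hperm hread hperm'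
  · by_cases hjS' : j ∈ S'
    · obtain ⟨Θ, τ, g, hisoΘ, h0', hτ, hτj, hτl, hτS, hτb, hrest⟩ :=
        exists_shear_chart_reading_of_mem hj hjS' hbj hF hclean hΘ0 hΘs hπ hperm hread hperm' hl hlS'
      refine ⟨Θ, τ, g, hisoΘ, h0', hτ, hτj, hτl, hτS, hτb, ?_⟩
      simp only [if_pos hjS']
      exact hrest
    · obtain ⟨Θ, τ, g, hisoΘ, h0', hτ, hτj, hτl, hτS, hτb, hrest⟩ :=
        exists_shear_chart_reading hj hjS' hbj hF hclean hΘ0 hΘs hπ hperm hread hperm' hl hlS' hjl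
      refine ⟨Θ, τ, g, hisoΘ, h0', hτ, hτj, hτl, hτS, hτb, ?_⟩
      simp only [if_neg hjS']
      exact hrest

end ChartDictionary

end Summit.ResolutionOfSingularities.ResolutionOfSingularities.Theorems.PIDim4

end
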